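import Summits.AtomisticToContinuum.Crystallization.Theorems.ChartedZeroExcessLayeredLatticeLiouvilleZU

/-!
# Part ZV «Link maps between Barlow graphs: code isomorphisms and cap-type vertices» (lens-2 g79, NODE 79 rider 5; imports ZU)

A map `g : ℤ³ → ℤ³` from the Barlow graph `BarlowAdj τ` to the Barlow graph `BarlowAdj τ'` is a LINK MAP at `x` (`IsLinkMap`) when it sends the twelve link
sites of `x` (`linkPt τ x i`, coded by `Fin 12` as in Part ZU) injectively to neighbours of `g x`, preserving and reflecting adjacency among them — the local
form of «isomorphism of contact graphs» that the transport step of (L2-C⟂′T) delivers on the registration window (memo NODE-g79 §12–§13).  Recoding the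
images at `g x` turns a link map into a CODE ISO (`IsCodeIso`): an injective self-map `c` of `Fin 12` carrying the adjacency table of the letter pair of
`x` to that of the letter pair of `g x`.  Everything below is then finite combinatorics of the two tables plus counting:

* `IsLinkMap.capType_or_c` ★ — `x` is CAP-TYPE (`CapType`: its six cross neighbours leave the layer of `g x`) OR `g x` is a c-vertex of `B_τ'`
  (`τ' ((g x).1 − 1) = τ' (g x).1`) — Part ZU's `caps_of_noCross` (F1) read through the code iso;
* `CapType.inLayer` ★ — a cap-type vertex's sheet hexagon goes INTO the layer of `g x` (six cross codes fill the six cross codes; counting);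
* `CapType.sides` ★ — its two cross triangles go ONTO the two caps of `g x`, one up and one down (triangles stay in one cap; six do not fit in three);
* `IsCodeIso.up_of_lo_lo` & co. — Part ZU's F3 (`upB_of_noCross_loB`, `loB_of_noCross_upB`) recoded: fixing one cap's side fixes the other's.

Part ZW uses these to PROPAGATE cap-type along Barlow paths (LEMMA D of the blueprint).  Pure combinatorics; no door-set hypothesis.  0 sorry.
-/

namespace Summit.AtomisticToContinuum.Crystallization.Theorems.ChartedZeroExcessLayeredLatticeLiouville

/-! ## ZV-1  Finite facts about the coded link (all `decide`) -/

/-- the coding is injective. [formal bookkeeping] -/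
theorem linkSite_injective (α β : Bool) : Function.Injective (linkSite α β) := by
  intro i j h; revert h; revert i j α β; decide

/-- sheet of a code: `0` iff in-sheet code. [formal bookkeeping] -/
theorem linkSite_fst_eq_zero_iff (α β : Bool) (j : Fin 12) : (linkSite α β j).1 = 0 ↔ j.val < 6 := by
  revert α β j; decide

/-- sheet of a code: `1` iff upper-cap code. [formal bookkeeping] -/
theorem linkSite_fst_eq_one_iff (α β : Bool) (j : Fin 12) : (linkSite α β j).1 = 1 ↔ 6 ≤ j.val ∧ j.val ≤ 8 := by
  revert α β j; decide

/-- sheet of a code: `−1` iff lower-cap code. [formal bookkeeping] -/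
theorem linkSite_fst_eq_neg_one_iff (α β : Bool) (j : Fin 12) : (linkSite α β j).1 = -1 ↔ 9 ≤ j.val := by
  revert α β j; decide

/-- within the caps, adjacency = distinct codes of the same cap (each cap is a triangle; the caps do not touch). [formal bookkeeping] -/
theorem linkAdj_cross_iff (α β : Bool) (i j : Fin 12) (hi : 6 ≤ i.val) (hj : 6 ≤ j.val) :
    linkAdj α β i j = true ↔ i ≠ j ∧ (i.val ≤ 8 ↔ j.val ≤ 8) := by
  revert hi hj; revert α β i j; decide

/-- the cap triangles and the cap/cap non-adjacency, as table values. [formal bookkeeping] -/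
theorem linkAdj_caps (α β : Bool) :
    linkAdj α β 6 7 = true ∧ linkAdj α β 6 8 = true ∧ linkAdj α β 7 8 = true ∧ linkAdj α β 9 10 = true ∧ linkAdj α β 9 11 = true ∧
      linkAdj α β 10 11 = true ∧ linkAdj α β 6 9 = false ∧ linkAdj α β 6 10 = false ∧ linkAdj α β 6 11 = false ∧ linkAdj α β 7 9 = false ∧
      linkAdj α β 7 10 = false ∧ linkAdj α β 7 11 = false ∧ linkAdj α β 8 9 = false ∧ linkAdj α β 8 10 = false ∧ linkAdj α β 8 11 = false := by
  revert α β; decide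

/-- the table is symmetric. [formal bookkeeping] -/
theorem linkAdj_comm (α β : Bool) (i j : Fin 12) : linkAdj α β i j = linkAdj α β j i := by
  revert α β i j; decide

/-- the centre is adjacent to every coded site. [formal bookkeeping] -/
theorem relAdjB_zero_linkSite (α β : Bool) (i : Fin 12) : relAdjB α β 0 (linkSite α β i) = true := by
  revert α β i; decide

/-- case list of the cross codes. [formal bookkeeping] -/
theorem cross_code_cases (i : Fin 12) (hi : 6 ≤ i.val) : i = 6 ∨ i = 7 ∨ i = 8 ∨ i = 9 ∨ i = 10 ∨ i = 11 := by
  revert hi; revert i; decide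

/-! ## ZV-2  Code isomorphisms between two coded links -/

/-- an injective, adjacency-table-preserving recoding of the link of one vertex (letters `α, β`) into the link of another (letters `α', β'`). [this file, g79] -/
def IsCodeIso (α β α' β' : Bool) (c : Fin 12 → Fin 12) : Prop :=
  Function.Injective c ∧ ∀ i j, linkAdj α β i j = linkAdj α' β' (c i) (c j)

/-- a code iso mapping cross codes to cross codes maps in-sheet codes to in-sheet codes (counting: six and six). [this file, g79] -/
theorem IsCodeIso.lt_six {α β α' β' : Bool} {c : Fin 12 → Fin 12} (h : IsCodeIso α β α' β' c) (hx : ∀ i, 6 ≤ i.val → 6 ≤ (c i).val)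
    (i : Fin 12) (hi : i.val < 6) : (c i).val < 6 := by
  by_contra hc
  have hc : 6 ≤ (c i).val := Nat.le_of_not_lt hc
  set s : Finset (Fin 12) := Finset.univ.filter fun j => 6 ≤ j.val with hs
  have hmaps : ∀ a ∈ s, c a ∈ s := by
    intro a ha; simp only [hs, Finset.mem_filter, Finset.mem_univ, true_and] at ha ⊢; exact hx a ha
  have hinj : Set.InjOn c s := fun a _ b _ hab => h.1 hab
  obtain ⟨a, ha, hca⟩ := Finset.surj_on_of_inj_on_of_card_le (fun a _ => c a) hmaps (fun a b ha hb hab => h.1 hab) le_rfl (c i)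
    (by simp only [hs, Finset.mem_filter, Finset.mem_univ, true_and]; exact hc)
  have hia : i = a := h.1 hca
  simp only [hs, Finset.mem_filter, Finset.mem_univ, true_and] at ha
  omega

/-- the three upper-cap codes of a code iso mapping cross codes to cross codes land in ONE cap, the three lower-cap codes in the OTHER. [this file, g79] -/
theorem IsCodeIso.sides {α β α' β' : Bool} {c : Fin 12 → Fin 12} (h : IsCodeIso α β α' β' c) (hx : ∀ i, 6 ≤ i.val → 6 ≤ (c i).val) :
    ((∀ i, 6 ≤ i.val → i.val ≤ 8 → (c i).val ≤ 8) ∧ ∀ i, 9 ≤ i.val → 9 ≤ (c i).val) ∨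
      ((∀ i, 6 ≤ i.val → i.val ≤ 8 → 9 ≤ (c i).val) ∧ ∀ i, 9 ≤ i.val → (c i).val ≤ 8) := by
  obtain ⟨h67, h68, h78, h910, h911, h1011, -⟩ := linkAdj_caps α β
  have A : ∀ i j : Fin 12, 6 ≤ i.val → 6 ≤ j.val → linkAdj α β i j = true → ((c i).val ≤ 8 ↔ (c j).val ≤ 8) := by
    intro i j hi hj hij
    rw [h.2] at hij
    exact ((linkAdj_cross_iff α' β' (c i) (c j) (hx i hi) (hx j hj)).1 hij).2
  have e67 := A 6 7 (by decide) (by decide) h67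
  have e68 := A 6 8 (by decide) (by decide) h68
  have e910 := A 9 10 (by decide) (by decide) h910
  have e911 := A 9 11 (by decide) (by decide) h911
  -- the two caps go to different sides: else six cross codes inject into one three-element cap
  have hne : ¬ ((c 6).val ≤ 8 ↔ (c 9).val ≤ 8) := by
    intro e69
    -- all six images on the side of `c 6`
    have all : ∀ i, 6 ≤ i.val → ((c i).val ≤ 8 ↔ (c 6).val ≤ 8) := by
      intro i hi
      rcases cross_code_cases i hi with rfl | rfl | rfl | rfl | rfl | rfl
      · exact Iff.rfl
      · exact e67.symm
      · exact e68.symm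
      · exact e69.symm
      · exact e910.symm.trans e69.symm
      · exact e911.symm.trans e69.symm
    rcases Nat.lt_or_ge (c 6).val 9 with h6 | h6
    · -- all six in the upper cap {6,7,8}
      set s : Finset (Fin 12) := Finset.univ.filter fun j => 6 ≤ j.val with hs
      set t : Finset (Fin 12) := Finset.univ.filter fun j => 6 ≤ j.val ∧ j.val ≤ 8 with ht
      have hmaps : ∀ a ∈ s, c a ∈ t := by
        intro a ha
        simp only [hs, ht, Finset.mem_filter, Finset.mem_univ, true_and] at ha ⊢
        exact ⟨hx a ha, (all a ha).2 (by omega)⟩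
      have hcard := Finset.card_le_card_of_injOn (fun a => c a) hmaps (fun a _ b _ hab => h.1 hab)
      have hs6 : s.card = 6 := by rw [hs]; decide
      have ht3 : t.card = 3 := by rw [ht]; decide
      omega
    · set s : Finset (Fin 12) := Finset.univ.filter fun j => 6 ≤ j.val with hs
      set t : Finset (Fin 12) := Finset.univ.filter fun j => 9 ≤ j.val with ht
      have hmaps : ∀ a ∈ s, c a ∈ t := by
        intro a ha
        simp only [hs, ht, Finset.mem_filter, Finset.mem_univ, true_and] at ha ⊢
        have := (all a ha)
        by_contra hlt
        have : (c 6).val ≤ 8 := this.1 (by omega)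
        omega
      have hcard := Finset.card_le_card_of_injOn (fun a => c a) hmaps (fun a _ b _ hab => h.1 hab)
      have hs6 : s.card = 6 := by rw [hs]; decide
      have ht3 : t.card = 3 := by rw [ht]; decide
      omega
  rcases Nat.lt_or_ge (c 6).val 9 with h6 | h6
  · left
    have h9 : 9 ≤ (c 9).val := by
      by_contra hlt; exact hne ⟨fun _ => by omega, fun _ => by omega⟩
    refine ⟨fun i hi hi' => ?_, fun i hi => ?_⟩
    · rcases cross_code_cases i hi with rfl | rfl | rfl | rfl | rfl | rfl <;> omega
    · rcases cross_code_cases i (by omega) with rfl | rfl | rfl | rfl | rfl | rfl <;> omega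
  · right
    have h9 : (c 9).val ≤ 8 := by
      by_contra hlt; exact hne ⟨fun _ => by omega, fun _ => by omega⟩
    refine ⟨fun i hi hi' => ?_, fun i hi => ?_⟩
    · rcases cross_code_cases i hi with rfl | rfl | rfl | rfl | rfl | rfl <;> omega
    · rcases cross_code_cases i (by omega) with rfl | rfl | rfl | rfl | rfl | rfl <;> omega


/-- (F3, recoded) a code iso keeping the lower cap low keeps the upper cap up. [this file, g79] -/
theorem IsCodeIso.up_of_lo_lo {α β α' β' : Bool} {c : Fin 12 → Fin 12} (h : IsCodeIso α β α' β' c) (hlo : ∀ j, 9 ≤ j.val → 9 ≤ (c j).val)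
    (i : Fin 12) (hi : 6 ≤ i.val) (hi' : i.val ≤ 8) : 6 ≤ (c i).val ∧ (c i).val ≤ 8 := by
  obtain ⟨h67, h68, h78, h910, h911, h1011, h69, h610, h611, h79, h710, h711, h89, h810, h811⟩ := linkAdj_caps α β
  have T : ∀ i j, linkAdj α' β' (c i) (c j) = linkAdj α β i j := fun i j => (h.2 i j).symm
  have ht : (c 6, c 7, c 8) ∈ linkTris α' β' := mem_linkTris (by rw [T]; exact h67) (by rw [T]; exact h68) (by rw [T]; exact h78)
  have hu : (c 9, c 10, c 11) ∈ linkTris α' β' := mem_linkTris (by rw [T]; exact h910) (by rw [T]; exact h911) (by rw [T]; exact h1011)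
  have hX : crossFreeB α' β' (c 6, c 7, c 8) (c 9, c 10, c 11) = true := by
    simp [crossFreeB, T, h69, h610, h611, h79, h710, h711, h89, h810, h811]
  have hl : loB (c 9, c 10, c 11) = true := by
    simp only [loB, Bool.and_eq_true, decide_eq_true_eq]; exact ⟨⟨hlo 9 (by decide), hlo 10 (by decide)⟩, hlo 11 (by decide)⟩
  have hup := upB_of_noCross_loB α' β' _ _ ht hu hX hl
  simp only [upB, Bool.and_eq_true, decide_eq_true_eq] at hup
  rcases cross_code_cases i hi with rfl | rfl | rfl | rfl | rfl | rfl
  · exact hup.1.1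
  · exact hup.1.2
  · exact hup.2
  all_goals omega

/-- (F3, recoded) a code iso lifting the lower cap up pushes the upper cap down. [this file, g79] -/
theorem IsCodeIso.lo_of_lo_up {α β α' β' : Bool} {c : Fin 12 → Fin 12} (h : IsCodeIso α β α' β' c)
    (hlo : ∀ j, 9 ≤ j.val → 6 ≤ (c j).val ∧ (c j).val ≤ 8) (i : Fin 12) (hi : 6 ≤ i.val) (hi' : i.val ≤ 8) : 9 ≤ (c i).val := by
  obtain ⟨h67, h68, h78, h910, h911, h1011, h69, h610, h611, h79, h710, h711, h89, h810, h811⟩ := linkAdj_caps α β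
  have T : ∀ i j, linkAdj α' β' (c i) (c j) = linkAdj α β i j := fun i j => (h.2 i j).symm
  have ht : (c 6, c 7, c 8) ∈ linkTris α' β' := mem_linkTris (by rw [T]; exact h67) (by rw [T]; exact h68) (by rw [T]; exact h78)
  have hu : (c 9, c 10, c 11) ∈ linkTris α' β' := mem_linkTris (by rw [T]; exact h910) (by rw [T]; exact h911) (by rw [T]; exact h1011)
  have hX : crossFreeB α' β' (c 6, c 7, c 8) (c 9, c 10, c 11) = true := by
    simp [crossFreeB, T, h69, h610, h611, h79, h710, h711, h89, h810, h811]
  have hl : upB (c 9, c 10, c 11) = true := by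
    simp only [upB, Bool.and_eq_true, decide_eq_true_eq]; exact ⟨⟨hlo 9 (by decide), hlo 10 (by decide)⟩, hlo 11 (by decide)⟩
  have hup := loB_of_noCross_upB α' β' _ _ ht hu hX hl
  simp only [loB, Bool.and_eq_true, decide_eq_true_eq] at hup
  rcases cross_code_cases i hi with rfl | rfl | rfl | rfl | rfl | rfl
  · exact hup.1.1
  · exact hup.1.2
  · exact hup.2
  all_goals omega

/-- (F3, recoded) a code iso keeping the upper cap up keeps the lower cap low. [this file, g79] -/
theorem IsCodeIso.lo_of_up_up {α β α' β' : Bool} {c : Fin 12 → Fin 12} (h : IsCodeIso α β α' β' c)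
    (hup : ∀ j, 6 ≤ j.val → j.val ≤ 8 → 6 ≤ (c j).val ∧ (c j).val ≤ 8) (i : Fin 12) (hi : 9 ≤ i.val) : 9 ≤ (c i).val := by
  obtain ⟨h67, h68, h78, h910, h911, h1011, h69, h610, h611, h79, h710, h711, h89, h810, h811⟩ := linkAdj_caps α β
  have T : ∀ i j, linkAdj α' β' (c i) (c j) = linkAdj α β i j := fun i j => (h.2 i j).symm
  have ht : (c 9, c 10, c 11) ∈ linkTris α' β' := mem_linkTris (by rw [T]; exact h910) (by rw [T]; exact h911) (by rw [T]; exact h1011)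
  have hu : (c 6, c 7, c 8) ∈ linkTris α' β' := mem_linkTris (by rw [T]; exact h67) (by rw [T]; exact h68) (by rw [T]; exact h78)
  have hX : crossFreeB α' β' (c 9, c 10, c 11) (c 6, c 7, c 8) = true := by
    simp [crossFreeB, T, linkAdj_comm α β 9, linkAdj_comm α β 10, linkAdj_comm α β 11, h69, h610, h611, h79, h710, h711, h89, h810, h811]
  have hl : upB (c 6, c 7, c 8) = true := by
    simp only [upB, Bool.and_eq_true, decide_eq_true_eq]
    exact ⟨⟨hup 6 (by decide) (by decide), hup 7 (by decide) (by decide)⟩, hup 8 (by decide) (by decide)⟩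
  have hlo := loB_of_noCross_upB α' β' _ _ ht hu hX hl
  simp only [loB, Bool.and_eq_true, decide_eq_true_eq] at hlo
  rcases cross_code_cases i (by omega) with rfl | rfl | rfl | rfl | rfl | rfl
  · omega
  · omega
  · omega
  · exact hlo.1.1
  · exact hlo.1.2
  · exact hlo.2

/-- (F3, recoded) a code iso pushing the upper cap down lifts the lower cap up. [this file, g79] -/
theorem IsCodeIso.up_of_up_lo {α β α' β' : Bool} {c : Fin 12 → Fin 12} (h : IsCodeIso α β α' β' c)
    (hup : ∀ j, 6 ≤ j.val → j.val ≤ 8 → 9 ≤ (c j).val) (i : Fin 12) (hi : 9 ≤ i.val) : 6 ≤ (c i).val ∧ (c i).val ≤ 8 := by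
  obtain ⟨h67, h68, h78, h910, h911, h1011, h69, h610, h611, h79, h710, h711, h89, h810, h811⟩ := linkAdj_caps α β
  have T : ∀ i j, linkAdj α' β' (c i) (c j) = linkAdj α β i j := fun i j => (h.2 i j).symm
  have ht : (c 9, c 10, c 11) ∈ linkTris α' β' := mem_linkTris (by rw [T]; exact h910) (by rw [T]; exact h911) (by rw [T]; exact h1011)
  have hu : (c 6, c 7, c 8) ∈ linkTris α' β' := mem_linkTris (by rw [T]; exact h67) (by rw [T]; exact h68) (by rw [T]; exact h78)
  have hX : crossFreeB α' β' (c 9, c 10, c 11) (c 6, c 7, c 8) = true := by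
    simp [crossFreeB, T, linkAdj_comm α β 9, linkAdj_comm α β 10, linkAdj_comm α β 11, h69, h610, h611, h79, h710, h711, h89, h810, h811]
  have hl : loB (c 6, c 7, c 8) = true := by
    simp only [loB, Bool.and_eq_true, decide_eq_true_eq]
    exact ⟨⟨hup 6 (by decide) (by decide), hup 7 (by decide) (by decide)⟩, hup 8 (by decide) (by decide)⟩
  have hhi := upB_of_noCross_loB α' β' _ _ ht hu hX hl
  simp only [upB, Bool.and_eq_true, decide_eq_true_eq] at hhi
  rcases cross_code_cases i (by omega) with rfl | rfl | rfl | rfl | rfl | rfl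
  · omega
  · omega
  · omega
  · exact hhi.1.1
  · exact hhi.1.2
  · exact hhi.2

/-! ## ZV-3  Link maps between two Barlow graphs -/

/-- the `i`-th link site of the vertex `x` of `B_τ` (letters read from `τ` at `x`). [this file, g79] -/
def linkPt (τ : ℤ → Bool) (x : ℤ × ℤ × ℤ) (i : Fin 12) : ℤ × ℤ × ℤ := shiftSite x (linkSite (τ (x.1 - 1)) (τ x.1) i)

/-- [formal bookkeeping] -/
theorem linkPt_fst (τ : ℤ → Bool) (x : ℤ × ℤ × ℤ) (i : Fin 12) : (linkPt τ x i).1 = x.1 + (linkSite (τ (x.1 - 1)) (τ x.1) i).1 := rfl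

/-- every vertex is adjacent to its link sites. [formal bookkeeping] -/
theorem barlowAdj_linkPt (τ : ℤ → Bool) (x : ℤ × ℤ × ℤ) (i : Fin 12) : BarlowAdj τ x (linkPt τ x i) := by
  have h0 : shiftSite x 0 = x := by simp [shiftSite]
  have h := barlowAdj_shift_iff τ x 0 (linkSite (τ (x.1 - 1)) (τ x.1) i) (by simp) (linkSite_fst _ _ i)
  rw [h0] at h
  exact h.2 ((relAdjB_iff _ _ _ _).1 (relAdjB_zero_linkSite _ _ i))

/-- every neighbour is a link linkPt. [formal bookkeeping] -/
theorem exists_linkPt_of_barlowAdj {τ : ℤ → Bool} {x y : ℤ × ℤ × ℤ} (h : BarlowAdj τ x y) : ∃ i, y = linkPt τ x i :=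
  exists_code_of_barlowAdj h

/-- adjacency of link sites is the table. [formal bookkeeping] -/
theorem barlowAdj_linkPt_iff (τ : ℤ → Bool) (x : ℤ × ℤ × ℤ) (i j : Fin 12) :
    BarlowAdj τ (linkPt τ x i) (linkPt τ x j) ↔ linkAdj (τ (x.1 - 1)) (τ x.1) i j = true :=
  barlowAdj_code_iff τ x i j

/-- a LINK MAP at `x`: `g` (from `B_τ` to `B_τ'`) maps the link sites of `x` injectively to neighbours of `g x`, preserving AND reflecting adjacency among
them — the local form of «isomorphism of contact graphs» that the transport lemma (g80, LEMMA B) delivers on the window. [this file, g79] -/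
def IsLinkMap (τ τ' : ℤ → Bool) (g : ℤ × ℤ × ℤ → ℤ × ℤ × ℤ) (x : ℤ × ℤ × ℤ) : Prop :=
  (∀ i, BarlowAdj τ' (g x) (g (linkPt τ x i))) ∧
    (∀ i j, BarlowAdj τ (linkPt τ x i) (linkPt τ x j) ↔ BarlowAdj τ' (g (linkPt τ x i)) (g (linkPt τ x j))) ∧ Function.Injective fun i => g (linkPt τ x i)

/-- `x` is CAP-TYPE under `g`: its six cross neighbours are mapped OUT of the layer of `g x` (equivalently, by `CapType.sides`, its two cross triangles go to
the two caps of `g x`, and by `CapType.inLayer` its sheet hexagon goes INTO the layer of `g x`). [this file, g79] -/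
def CapType (τ : ℤ → Bool) (g : ℤ × ℤ × ℤ → ℤ × ℤ × ℤ) (x : ℤ × ℤ × ℤ) : Prop :=
  ∀ i : Fin 12, 6 ≤ i.val → (g (linkPt τ x i)).1 ≠ (g x).1

/-- a link map is coded by a code iso. [this file, g79] -/
theorem IsLinkMap.exists_codeIso {τ τ' : ℤ → Bool} {g : ℤ × ℤ × ℤ → ℤ × ℤ × ℤ} {x : ℤ × ℤ × ℤ} (h : IsLinkMap τ τ' g x) :
    ∃ c : Fin 12 → Fin 12, IsCodeIso (τ (x.1 - 1)) (τ x.1) (τ' ((g x).1 - 1)) (τ' (g x).1) c ∧ ∀ i, g (linkPt τ x i) = linkPt τ' (g x) (c i) := by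
  choose c hc using fun i => exists_linkPt_of_barlowAdj (h.1 i)
  refine ⟨c, ⟨fun i j hij => h.2.2 ((hc i).trans ((congrArg (linkPt τ' (g x)) hij).trans (hc j).symm)), fun i j => ?_⟩, hc⟩
  rw [Bool.eq_iff_iff, ← barlowAdj_linkPt_iff τ x i j, h.2.1 i j, hc i, hc j, barlowAdj_linkPt_iff]

/-- cap-type read off the codes. [formal bookkeeping] -/
theorem capType_iff_codes {τ τ' : ℤ → Bool} {g : ℤ × ℤ × ℤ → ℤ × ℤ × ℤ} {x : ℤ × ℤ × ℤ} {c : Fin 12 → Fin 12}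
    (hc : ∀ i, g (linkPt τ x i) = linkPt τ' (g x) (c i)) : CapType τ g x ↔ ∀ i : Fin 12, 6 ≤ i.val → 6 ≤ (c i).val := by
  refine forall₂_congr fun i _ => ?_
  rw [hc i, linkPt_fst]
  have h0 := linkSite_fst_eq_zero_iff (τ' ((g x).1 - 1)) (τ' (g x).1) (c i)
  constructor
  · intro hne; by_contra hlt; exact hne (by rw [h0.2 (by omega)]; ring)
  · intro hle heq; exact absurd (h0.1 (by linarith)) (by omega)

/-- ★ THE LOCAL ALTERNATIVE: under a link map, a vertex is cap-type or its image is a c-vertex (ZU's F1, recoded). [this file, g79] -/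
theorem IsLinkMap.capType_or_c {τ τ' : ℤ → Bool} {g : ℤ × ℤ × ℤ → ℤ × ℤ × ℤ} {x : ℤ × ℤ × ℤ} (h : IsLinkMap τ τ' g x) :
    CapType τ g x ∨ τ' ((g x).1 - 1) = τ' (g x).1 := by
  obtain ⟨c, hI, hc⟩ := h.exists_codeIso
  obtain ⟨h67, h68, h78, h910, h911, h1011, h69, h610, h611, h79, h710, h711, h89, h810, h811⟩ := linkAdj_caps (τ (x.1 - 1)) (τ x.1)
  have T : ∀ i j, linkAdj (τ' ((g x).1 - 1)) (τ' (g x).1) (c i) (c j) = linkAdj (τ (x.1 - 1)) (τ x.1) i j := fun i j => (hI.2 i j).symm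
  have ht : (c 6, c 7, c 8) ∈ linkTris (τ' ((g x).1 - 1)) (τ' (g x).1) :=
    mem_linkTris (by rw [T]; exact h67) (by rw [T]; exact h68) (by rw [T]; exact h78)
  have hu : (c 9, c 10, c 11) ∈ linkTris (τ' ((g x).1 - 1)) (τ' (g x).1) :=
    mem_linkTris (by rw [T]; exact h910) (by rw [T]; exact h911) (by rw [T]; exact h1011)
  have hX : crossFreeB (τ' ((g x).1 - 1)) (τ' (g x).1) (c 6, c 7, c 8) (c 9, c 10, c 11) = true := by
    simp [crossFreeB, T, h69, h610, h611, h79, h710, h711, h89, h810, h811]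
  rcases caps_of_noCross _ _ _ _ ht hu hX with ⟨h1, h2⟩ | ⟨h1, h2⟩ | e
  · left; rw [capType_iff_codes hc]; intro i hi
    simp only [upB, loB, Bool.and_eq_true, decide_eq_true_eq] at h1 h2
    rcases cross_code_cases i hi with rfl | rfl | rfl | rfl | rfl | rfl <;> omega
  · left; rw [capType_iff_codes hc]; intro i hi
    simp only [upB, loB, Bool.and_eq_true, decide_eq_true_eq] at h1 h2
    rcases cross_code_cases i hi with rfl | rfl | rfl | rfl | rfl | rfl <;> omega
  · exact Or.inr e

/-- ★ a cap-type vertex's sheet hexagon is mapped INTO the layer of its image. [this file, g79] -/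
theorem CapType.inLayer {τ τ' : ℤ → Bool} {g : ℤ × ℤ × ℤ → ℤ × ℤ × ℤ} {x : ℤ × ℤ × ℤ} (hcap : CapType τ g x) (h : IsLinkMap τ τ' g x)
    (i : Fin 12) (hi : i.val < 6) : (g (linkPt τ x i)).1 = (g x).1 := by
  obtain ⟨c, hI, hc⟩ := h.exists_codeIso
  have hlt := hI.lt_six ((capType_iff_codes hc).1 hcap) i hi
  rw [hc i, linkPt_fst, (linkSite_fst_eq_zero_iff _ _ (c i)).2 hlt, add_zero]

/-- ★ a cap-type vertex's cross triangles are mapped ONTO the two caps of its image (one up, one down). [this file, g79] -/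
theorem CapType.sides {τ τ' : ℤ → Bool} {g : ℤ × ℤ × ℤ → ℤ × ℤ × ℤ} {x : ℤ × ℤ × ℤ} (hcap : CapType τ g x) (h : IsLinkMap τ τ' g x) :
    ((∀ i : Fin 12, 6 ≤ i.val → i.val ≤ 8 → (g (linkPt τ x i)).1 = (g x).1 + 1) ∧ ∀ i : Fin 12, 9 ≤ i.val → (g (linkPt τ x i)).1 = (g x).1 - 1) ∨
      ((∀ i : Fin 12, 6 ≤ i.val → i.val ≤ 8 → (g (linkPt τ x i)).1 = (g x).1 - 1) ∧
        ∀ i : Fin 12, 9 ≤ i.val → (g (linkPt τ x i)).1 = (g x).1 + 1) := by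
  obtain ⟨c, hI, hc⟩ := h.exists_codeIso
  have hx := (capType_iff_codes hc).1 hcap
  have one := linkSite_fst_eq_one_iff (τ' ((g x).1 - 1)) (τ' (g x).1)
  have neg := linkSite_fst_eq_neg_one_iff (τ' ((g x).1 - 1)) (τ' (g x).1)
  rcases hI.sides hx with ⟨hu, hl⟩ | ⟨hu, hl⟩
  · left
    refine ⟨fun i hi hi' => ?_, fun i hi => ?_⟩
    · rw [hc i, linkPt_fst, (one (c i)).2 ⟨hx i hi, hu i hi hi'⟩]
    · rw [hc i, linkPt_fst, (neg (c i)).2 (hl i hi)]; ring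
  · right
    refine ⟨fun i hi hi' => ?_, fun i hi => ?_⟩
    · rw [hc i, linkPt_fst, (neg (c i)).2 (hu i hi hi')]; ring
    · rw [hc i, linkPt_fst, (one (c i)).2 ⟨hx i (by omega), hl i hi⟩]

end Summit.AtomisticToContinuum.Crystallization.Theorems.ChartedZeroExcessLayeredLatticeLiouville
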